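import Literature.NumberTheory.EllipticCurves.CanonicalPAdicHeightIntegralityProofs
import HarnessLib

/-!
# The canonical cyclotomic `p`-adic height at an ANOMALOUS good prime: Mazur–Tate's value subgroup
# with the term `n_{A_p}` — `ord_p ⟨P, Q⟩ ≥ 1 − 2·ord_p #Ẽ(𝔽_p)`, `ord_p Reg_p ≥ (1 − 2·ord_p #Ẽ(𝔽_p))·rank`

Topic `Literature/NumberTheory/EllipticCurves`; `Proofs`-style companion of
`CanonicalPAdicHeightIntegralityProofs.lean` (THEOREMS ONLY: no definition, no named fact, no instance).
Written by the prover seat `bsd-schneider-i1-c2` (gen 5, cell `bsd-schneider-ideate`) for corner A2 of the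
BSD rank-one residual (anomalous Eisenstein primes), where the sibling file's `norm_pairing_le_of_not_anomalous`
does not apply.

## The printed statement and its proof

Mazur–Tate 1983, §3.3 (display after (3.3.4)) with (4.1.1)–(4.1.2) and (4.4) Prop.: the canonical
`ρ`-pairing takes values in `… + Σ_{v∉S,𝒱_∞} (1/m_{A_v}) ρ_v(K_v^*) + (1/m_{A_p})[ρ_p(K_p^*) +
(1/(m_{B_p} n_{A_p} n_{B_p})) ρ_p(𝔬_p^*)]`, `n_{A_p}` the exponent of `A₀⁰(k_p)/(torus) = Ẽ(𝔽_p)` at a good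
`p`. For `E/ℚ`, `ρ = ρ_c = log_p ∘ χ` (`ρ_p(𝔬_p^*) ⊆ pℤ_p`, `p` odd) this reads
`ord_p ⟨P, Q⟩ ≥ 1 − max(max_ℓ ord_p m_ℓ, 2·ord_p n_p)`. The sibling file proves the case `p ∤ n_p`
(non-anomalous) and `p ∤ m_ℓ`: `⟨P, Q⟩ ∈ pℤ_p`. Here, under the same Tamagawa-index hypothesis
`p ∤ [E(ℚ) : E(ℚ) ∩ E⁰(ℚ_ℓ)]` but WITHOUT the anomalous restriction: every non-torsion `P` has the admissible
multiple `mP`, `m = N_p·m₀` with `p ∤ m₀` (`N_p = #Ẽ(𝔽_p)`, AEC VII.2.1), so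
`ĥ_p(P) = ĥ_p(mP)/m²` has `ord_p ĥ_p(P) ≥ 1 − 2·ord_p N_p` (the Mazur–Stein–Tate form of the same bound,
MST06 Alg. 3.4; at an anomalous `p ≥ 5`, `ord_p N_p = 1` and the floor is `−1` — MST06 §4, `37a1` at `p = 53`:
"the regulator … is `26·53⁻² + …`", i.e. `ord₅₃ Reg = −1` in their normalisation `h_p = ⟨,⟩/(−2p)`).
Consequently `ord_p Reg_p ≥ (1 − 2·ord_p N_p) · rank` (ultrametric Hadamard, as in the sibling file).

## What is here

* `exists_admissible_nsmul_padicValNat_eq` — the admissible multiple `mP` with `ord_p m = ord_p N_p`, `m ≠ 0`.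
* `norm_pairing_self_le_of_not_dvd_index`, `norm_pairing_le_of_not_dvd_index` — `‖⟨P, Q⟩‖ ≤ p^{2·ord_p N_p − 1}`.
* `norm_padicRegulator_le_of_not_dvd_index` — `‖Reg_p‖ ≤ (p^{2·ord_p N_p − 1})^{rank}`;
  `valuation_padicRegulator_ge_of_not_dvd_index` — `Reg_p ≠ 0 ⇒ (1 − 2·ord_p N_p)·rank ≤ ord_p Reg_p`.

## References

* B. Mazur, J. Tate, *Canonical height pairings via biextensions*, Progr. Math. 35 (1983): §3.3 (display
  after (3.3.4)), (4.1.1)–(4.1.2), (4.4) Prop. [MazurTate1983Biext]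
* B. Mazur, W. Stein, J. Tate, Doc. Math. Extra Vol. Coates (2006), §1 (1.1), Alg. 3.4 (step 1), §4 p. 19
  (`37a1`, `p = 53`). [MazurSteinTate2006]
* J. H. Silverman, AEC 2nd ed., VII.2.1, VII.6.1. [SilvermanAEC2009]
-/

noncomputable section

open scoped Classical

namespace WeierstrassCurve

open Literature.NumberTheory.EllipticCurves

section Anomalous

variable (W : WeierstrassCurve ℚ) [W.IsElliptic] [W.IsGloballyMinimal] (p : ℕ) [Fact p.Prime]

omit [W.IsElliptic] in
/-- **An admissible multiple `mP` with `ord_p m = ord_p #Ẽ(𝔽_p)`** (anomalous primes allowed). For `W/ℚ`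
globally minimal, a good prime `p ≥ 3` with `p ∤ [E(ℚ) : E(ℚ) ∩ E⁰(ℚ_ℓ)]` for every prime `ℓ` and a
non-torsion `P ∈ E(ℚ)`: `m = N_p · ∏_{ℓ bad for P} [E(ℚ) : E(ℚ) ∩ E⁰(ℚ_ℓ)]` works (`N_p·E(ℚ) ⊆ E₁(ℚ_p)`,
AEC VII.2.1; the index multiple lies in `E⁰(ℚ_ℓ)`), and `ord_p m = ord_p N_p` since the indices are prime to
`p`. Mazur–Tate's exponents `n_{A_p}`, `m_{A_ℓ}`. [cite: MazurTate1983Biext, §1.2 and (4.1.2)]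
[cite: MazurSteinTate2006, Alg. 3.4 step 1] [cite: SilvermanAEC2009, VII.2.1 and VII.6.1] -/
theorem exists_admissible_nsmul_padicValNat_eq (hp : 3 ≤ p) (hgood : W.HasGoodReductionAtPrime p)
    (hidx : ∀ (ℓ : ℕ) [Fact ℓ.Prime], ¬ p ∣ (W.nonsingularReductionSubgroupAt ℓ).index)
    (P : W.toAffine.Point) (hP : ¬ IsOfFinAddOrder P) :
    ∃ m : ℕ, m ≠ 0 ∧ padicValNat p m = padicValNat p (W.reductionPointCount p) ∧
      W.IsAdmissible p (m • P) := by
  have hpp : p.Prime := Fact.out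
  have hp2 : p ≠ 2 := by omega
  have hΔ : ¬ (p : ℤ) ∣ minimalDiscriminantInt W :=
    not_dvd_minimalDiscriminantInt_of_hasGoodReductionAtPrime' W p hgood
  have hNp0 : W.reductionPointCount p ≠ 0 := (W.reductionPointCount_pos p).ne'
  obtain ⟨x, y, h, rfl⟩ := exists_eq_some_of_not_isOfFinAddOrder hP
  -- the finitely many primes at which `P` may have singular reduction
  obtain ⟨S, hS⟩ := exists_finset_forall_hasNonsingularReductionAt h
  set e0 : ℕ → ℕ := fun ℓ =>
    if hℓ : ℓ.Prime then (haveI := Fact.mk hℓ; (W.nonsingularReductionSubgroupAt ℓ).index) else 1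
    with he0def
  have he0 : ∀ ℓ, ¬ p ∣ e0 ℓ := fun ℓ => by
    simp only [he0def]
    split_ifs with hℓ
    · haveI := Fact.mk hℓ; exact hidx ℓ
    · exact hpp.not_dvd_one
  set m₀ := ∏ ℓ ∈ S, e0 ℓ with hm₀
  have hm₀p : ¬ p ∣ m₀ := by
    rw [hm₀]
    intro hdvd
    obtain ⟨ℓ, -, hℓ⟩ := (Prime.dvd_finsetProd_iff hpp.prime _).mp hdvd
    exact he0 ℓ hℓ
  have hm₀0 : m₀ ≠ 0 := fun h0 ↦ hm₀p (h0 ▸ dvd_zero p)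
  have hm₀P : ∀ ℓ : ℕ, (hℓ : ℓ.Prime) → haveI := Fact.mk hℓ;
      m₀ • (Affine.Point.some x y h) ∈ W.nonsingularReductionSubgroupAt ℓ := by
    intro ℓ hℓ
    haveI := Fact.mk hℓ
    by_cases hℓS : ℓ ∈ S
    · obtain ⟨k, hk⟩ : e0 ℓ ∣ m₀ := Finset.dvd_prod_of_mem e0 hℓS
      rw [hk, mul_nsmul (Affine.Point.some x y h)]
      refine AddSubgroup.nsmul_mem _ ?_ k
      have : e0 ℓ = (W.nonsingularReductionSubgroupAt ℓ).index := by simp only [he0def, dif_pos hℓ]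
      rw [this]
      exact AddSubgroup.nsmul_index_mem _ _
    · exact AddSubgroup.nsmul_mem _ ((mem_nonsingularReductionSubgroupAt_iff _).mpr
        ((W.reducesNonsingularlyAt_some ℓ h).mpr (hS ℓ hℓ hℓS))) m₀
  -- `Q = (m₀ N_p) P` lies in `E₁` at `p` and in `E₀` at every prime, and is non-torsion
  have hQfin : ¬ IsOfFinAddOrder ((m₀ * W.reductionPointCount p) • (Affine.Point.some x y h)) :=
    fun hf => hP (hf.of_nsmul (Nat.mul_ne_zero hm₀0 hNp0))
  have hQ₀ : ∀ ℓ : ℕ, (hℓ : ℓ.Prime) → haveI := Fact.mk hℓ;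
      (m₀ * W.reductionPointCount p) • (Affine.Point.some x y h) ∈
        W.nonsingularReductionSubgroupAt ℓ := by
    intro ℓ hℓ
    haveI := Fact.mk hℓ
    rw [mul_nsmul (Affine.Point.some x y h)]
    exact AddSubgroup.nsmul_mem _ (hm₀P ℓ hℓ) _
  have hker := W.isInReductionKernel_reductionPointCount_nsmul p hΔ
    (W.toPadicPoint p (m₀ • Affine.Point.some x y h))
  rw [← map_nsmul, ← mul_nsmul] at hker
  obtain ⟨xq, yq, hq, hQeq⟩ := exists_eq_some_of_not_isOfFinAddOrder hQfin
  rw [hQeq] at hQ₀ hQfin hker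
  rw [toPadicPoint_some, isInReductionKernel_some] at hker
  refine ⟨m₀ * W.reductionPointCount p, Nat.mul_ne_zero hm₀0 hNp0, ?_, ?_⟩
  · rw [padicValNat.mul hm₀0 hNp0, padicValNat.eq_zero_of_not_dvd hm₀p, zero_add]
  rw [hQeq]
  refine ⟨hQfin, hker, (W.inSigmaDisc_of_one_lt_norm hp2 hq hker).2, fun ℓ hℓ => ?_⟩
  haveI := Fact.mk hℓ
  exact (W.reducesNonsingularlyAt_some ℓ _).mp ((mem_nonsingularReductionSubgroupAt_iff _).mp (hQ₀ ℓ hℓ))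

omit [W.IsElliptic] in
/-- **`‖⟨P, P⟩‖ ≤ p^{2·ord_p #Ẽ(𝔽_p) − 1}` at any good prime `p ≥ 3` with `p ∤ [E(ℚ) : E(ℚ) ∩ E⁰(ℚ_ℓ)]`**
(THE canonical datum): `⟨mP, mP⟩ = m²⟨P, P⟩ ∈ pℤ_p` for the admissible multiple of
`exists_admissible_nsmul_padicValNat_eq` (`norm_pairing_self_le_of_isAdmissible`), and `‖m‖ = p^{−ord_p N_p}`.
Mazur–Tate's term `(1/n_{A_p}²)·ρ_p(𝔬_p^*)`; at an anomalous `p` this is the floor `ord_p ⟨P,P⟩ ≥ −1`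
(MST06 §4: `37a1` at `p = 53`). [cite: MazurTate1983Biext, §3.3 (display after (3.3.4)) and (4.1.1)]
[cite: MazurSteinTate2006, §1 (1.1), Alg. 3.4 and §4 p. 19] -/
theorem norm_pairing_self_le_of_not_dvd_index (hp : 3 ≤ p) (hgood : W.HasGoodReductionAtPrime p)
    (hidx : ∀ (ℓ : ℕ) [Fact ℓ.Prime], ¬ p ∣ (W.nonsingularReductionSubgroupAt ℓ).index)
    {D : PAdicHeightData W p} (hD : D.IsCanonical) (P : W.toAffine.Point) :
    ‖D.pairing P P‖ ≤ (p : ℝ) ^ (2 * (padicValNat p (W.reductionPointCount p) : ℤ) - 1) := by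
  have hpp : p.Prime := Fact.out
  have hp2 : p ≠ 2 := by omega
  have hp1 : (1 : ℝ) < p := by exact_mod_cast hpp.one_lt
  have hp0 : (0 : ℝ) < p := by positivity
  by_cases hP : IsOfFinAddOrder P
  · rw [D.map_torsion P P hP, norm_zero]; positivity
  obtain ⟨m, hm0, hvm, hmP⟩ := exists_admissible_nsmul_padicValNat_eq W p hp hgood hidx P hP
  have hmm : D.pairing (m • P) (m • P) = ((m : ℚ_[p]) * m) * D.pairing P P := by
    rw [map_nsmul (D.pairing (m • P)) m P, D.symm (m • P) P, map_nsmul (D.pairing P) m P, smul_smul,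
      nsmul_eq_mul, Nat.cast_mul]
  have key := norm_pairing_self_le_of_isAdmissible W p hp2 hD hmP
  rw [hmm, norm_mul, norm_mul] at key
  -- `‖m‖ = p^{-ord_p N_p}`
  have hmnorm : ‖(m : ℚ_[p])‖ = (p : ℝ) ^ (-(padicValNat p (W.reductionPointCount p) : ℤ)) := by
    have : ((m : ℚ) : ℚ_[p]) = (m : ℚ_[p]) := by push_cast; rfl
    rw [← this, Padic.norm_eq_zpow_neg_valuation (by exact_mod_cast hm0), Padic.valuation_ratCast,
      padicValRat.of_nat, hvm]
  rw [hmnorm] at key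
  have hmpos : (0 : ℝ) < (p : ℝ) ^ (-(padicValNat p (W.reductionPointCount p) : ℤ)) := zpow_pos hp0 _
  -- divide
  have key' : ‖D.pairing P P‖ ≤ (p : ℝ)⁻¹ /
      ((p : ℝ) ^ (-(padicValNat p (W.reductionPointCount p) : ℤ)) *
        (p : ℝ) ^ (-(padicValNat p (W.reductionPointCount p) : ℤ))) := by
    rw [le_div_iff₀ (mul_pos hmpos hmpos)]
    linarith [key, mul_comm (‖D.pairing P P‖)
      ((p : ℝ) ^ (-(padicValNat p (W.reductionPointCount p) : ℤ)) *
        (p : ℝ) ^ (-(padicValNat p (W.reductionPointCount p) : ℤ)))]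
  refine key'.trans (le_of_eq ?_)
  rw [← zpow_add₀ hp0.ne', ← zpow_neg_one, div_eq_mul_inv, ← zpow_neg, ← zpow_add₀ hp0.ne']
  congr 1
  ring

omit [W.IsElliptic] in
/-- **`‖⟨P, Q⟩‖ ≤ p^{2·ord_p #Ẽ(𝔽_p) − 1}` for all `P, Q`** (same hypotheses; polarisation, `‖2‖ = 1` for
odd `p`). Mazur–Tate 1983 §3.3 for `E/ℚ`, `ρ = ρ_c`, at a good prime with `p ∤ m_ℓ`, the `n_p`-term kept.
[cite: MazurTate1983Biext, §3.3 (display after (3.3.4)), (4.1.1)–(4.1.2), (4.4) Prop.] -/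
theorem norm_pairing_le_of_not_dvd_index (hp : 3 ≤ p) (hgood : W.HasGoodReductionAtPrime p)
    (hidx : ∀ (ℓ : ℕ) [Fact ℓ.Prime], ¬ p ∣ (W.nonsingularReductionSubgroupAt ℓ).index)
    {D : PAdicHeightData W p} (hD : D.IsCanonical) (P Q : W.toAffine.Point) :
    ‖D.pairing P Q‖ ≤ (p : ℝ) ^ (2 * (padicValNat p (W.reductionPointCount p) : ℤ) - 1) := by
  have hpp : p.Prime := Fact.out
  have hp2 : p ≠ 2 := by omega
  set c : ℝ := (p : ℝ) ^ (2 * (padicValNat p (W.reductionPointCount p) : ℤ) - 1) with hc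
  have hdiag : ∀ R : W.toAffine.Point, ‖D.pairing R R‖ ≤ c := fun R ↦
    norm_pairing_self_le_of_not_dvd_index W p hp hgood hidx hD R
  have hpol : (2 : ℚ_[p]) * D.pairing P Q =
      D.pairing (P + Q) (P + Q) - D.pairing P P - D.pairing Q Q := by
    simp only [map_add, AddMonoidHom.add_apply, D.symm Q P]; ring
  have hsub : ∀ a b : ℚ_[p], ‖a - b‖ ≤ max ‖a‖ ‖b‖ := fun a b ↦ by
    rw [sub_eq_add_neg, ← norm_neg b]; exact IsUltrametricDist.norm_add_le_max a (-b)
  have h2 : ‖(2 : ℚ_[p])‖ = 1 := by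
    have : ((2 : ℕ) : ℚ_[p]) = 2 := by norm_num
    rw [← this, Padic.norm_natCast_eq_one_iff]
    exact (Nat.coprime_primes hpp Nat.prime_two).mpr hp2
  have key : ‖(2 : ℚ_[p]) * D.pairing P Q‖ ≤ c := by
    rw [hpol]
    refine (hsub _ _).trans (max_le ?_ (hdiag Q))
    exact (hsub _ _).trans (max_le (hdiag _) (hdiag P))
  rwa [norm_mul, h2, one_mul] at key

omit [W.IsElliptic] [W.IsGloballyMinimal] in
/-- Ultrametric Hadamard bound: a square matrix over `ℚ_p` with all entries of norm `≤ c` has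
determinant of norm `≤ c^n` (Leibniz expansion; the sibling file's private lemma, restated). [folklore] -/
private theorem norm_det_le_pow_card_of_forall_norm_le' {ι : Type*} [Fintype ι] {c : ℝ} (hc : 0 ≤ c)
    (M : Matrix ι ι ℚ_[p]) (hM : ∀ i j, ‖M i j‖ ≤ c) : ‖M.det‖ ≤ c ^ Fintype.card ι := by
  rw [Matrix.det_apply]
  refine IsUltrametricDist.norm_sum_le_of_forall_le_of_nonneg (pow_nonneg hc _) fun σ _ ↦ ?_
  have hsign : ‖Equiv.Perm.sign σ • ∏ i, M (σ i) i‖ = ‖∏ i, M (σ i) i‖ := by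
    rcases Int.units_eq_one_or (Equiv.Perm.sign σ) with h | h
    · rw [h, one_smul]
    · rw [h, Units.neg_smul, one_smul, norm_neg]
  rw [hsign, norm_prod]
  calc ∏ i, ‖M (σ i) i‖ ≤ ∏ _i : ι, c :=
        Finset.prod_le_prod (fun i _ ↦ norm_nonneg _) (fun i _ ↦ hM _ _)
    _ = c ^ Fintype.card ι := by rw [Finset.prod_const, Finset.card_univ]

omit [W.IsGloballyMinimal] in
/-- Ultrametric Hadamard for the regulator: pairing values of norm `≤ c` (`0 ≤ c`) give
`‖Reg_p(D)‖ ≤ c^{rank}` (the regulator is the Gram determinant of a Mordell–Weil basis,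
`padicRegulatorOf_eq_padicRegulator_holds`). [cite: KunduRay2024, §3 (display before Thm 3.6)] -/
theorem norm_padicRegulator_le_pow_of_forall_norm_pairing_le {D : PAdicHeightData W p} {c : ℝ} (hc : 0 ≤ c)
    (h : ∀ P Q : W.toAffine.Point, ‖D.pairing P Q‖ ≤ c) :
    ‖padicRegulator D‖ ≤ c ^ W.mordellWeilRank := by
  obtain ⟨P, hP⟩ := W.exists_isMordellWeilBasis_holds
  rw [← hP.padicRegulatorOf_eq_padicRegulator D]
  have hdet := norm_det_le_pow_card_of_forall_norm_le' (p := p) hc (D.pairingMatrix P)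
    (fun i j ↦ show ‖D.pairing (P i) (P j)‖ ≤ _ from h _ _)
  rwa [Fintype.card_fin] at hdet

/-- **`‖Reg_p‖ ≤ (p^{2·ord_p #Ẽ(𝔽_p) − 1})^{rank}`** at a good prime `p ≥ 3` with `p ∤ [E(ℚ) : E(ℚ) ∩ E⁰(ℚ_ℓ)]`
for all `ℓ`, for THE canonical datum. [cite: MazurTate1983Biext, §3.3 and (4.1.1)]
[cite: KunduRay2024, §3 (display before Thm 3.6)] -/
theorem norm_padicRegulator_le_of_not_dvd_index (hp : 3 ≤ p) (hgood : W.HasGoodReductionAtPrime p)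
    (hidx : ∀ (ℓ : ℕ) [Fact ℓ.Prime], ¬ p ∣ (W.nonsingularReductionSubgroupAt ℓ).index)
    {D : PAdicHeightData W p} (hD : D.IsCanonical) :
    ‖padicRegulator D‖ ≤
      ((p : ℝ) ^ (2 * (padicValNat p (W.reductionPointCount p) : ℤ) - 1)) ^ W.mordellWeilRank :=
  norm_padicRegulator_le_pow_of_forall_norm_pairing_le W p (by positivity)
    (norm_pairing_le_of_not_dvd_index W p hp hgood hidx hD)

/-- **Valuation form: `Reg_p ≠ 0 ⇒ (1 − 2·ord_p #Ẽ(𝔽_p)) · rank ≤ ord_p Reg_p`** (same hypotheses). At an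
anomalous `p ≥ 5` (`ord_p #Ẽ(𝔽_p) = 1`) in rank one this is the floor `ord_p Reg_p ≥ −1` observed on every
pair of the cells' censuses (MST06 §4: `37a1` at `p = 53` attains it). [cite: MazurTate1983Biext, §3.3 and (4.1.1)]
[cite: MazurSteinTate2006, §4 p. 19] -/
theorem valuation_padicRegulator_ge_of_not_dvd_index (hp : 3 ≤ p) (hgood : W.HasGoodReductionAtPrime p)
    (hidx : ∀ (ℓ : ℕ) [Fact ℓ.Prime], ¬ p ∣ (W.nonsingularReductionSubgroupAt ℓ).index)
    {D : PAdicHeightData W p} (hD : D.IsCanonical) (hR : padicRegulator D ≠ 0) :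
    (1 - 2 * (padicValNat p (W.reductionPointCount p) : ℤ)) * W.mordellWeilRank ≤
      (padicRegulator D).valuation := by
  have hpp : p.Prime := Fact.out
  have hp1 : (1 : ℝ) < p := by exact_mod_cast hpp.one_lt
  have h := norm_padicRegulator_le_of_not_dvd_index W p hp hgood hidx hD
  rw [Padic.norm_eq_zpow_neg_valuation hR, ← zpow_natCast, ← zpow_mul] at h
  have h' := (zpow_le_zpow_iff_right₀ hp1).mp h
  linarith

end Anomalous

end WeierstrassCurve

end
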